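import Summits.Ventures.Crystal3D.Theorems.StickyWulffConstantNoReconstructionGainBasalBarlowFilm
import HarnessLib

/-!
# Basal Barlow films seen from another `(111)` axis: the eighteen contact vectors and their heights

HONEST FRAMING. Part of the venture `Summits/Ventures/Crystal3D` (cell `crystal3d-full`), helper
`--supports` the crux `NoReconstructionGain` (stmt-Ventures-19144, route
`route-Ventures-StickyWulffConstant`), line `adhesion`.  Local bookkeeping for the rung
`axisBarlowFilm_adhesion` (`…AxisBarlowFilm`): basal-family Barlow films (`⊆ B = Λ₀ ∪ (Λ₀ ± w)`)
at the normal `m = (u + v + t)/√6` — a NON-basal `(111)` axis of `Λ₀ = fccStacking 1 √(2/3)`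
(`u, v, t` the sites `(0,1,0), (0,0,1), (1,0,0)`, `u + v + t = barlowPos 1 1 1`, `w = barlowOffset 1`).

* `fcc_coset_unit_vectors` — the unit vectors of the coset `Λ₀ + w` are EXACTLY the three
  "twin-hollow" vectors `t − u − v + w`, `t − v + w`, `t − u + w` (Diophantine enumeration);
* `basal_unit_vectors` — two points of `B` at distance `1` differ by one of the twelve bond vectors
  `± pos c` or by `±` one of the three twin-hollow vectors (eighteen directions in all);
* `inner_axis_barlowPos`, `inner_axis_barlowOffset` — heights along `u + v + t`:
  `⟪pos (k,i,j), u+v+t⟫ = 2(i+j+k)`, `⟪w, u+v+t⟫ = 4/3`;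
* `norm_sq_barlowOffset'`, `norm_sq_barlowOffset_sub_u`, `norm_sq_barlowOffset_sub_v` — `= 1/3`: the
  three incompatibilities (two balls at these relative positions would overlap) used by the
  per-ball count.

WHAT THIS IS NOT: any statement about packings; rung F-C1 not moved.
-/

noncomputable section

namespace Summit.Ventures.Crystal3D.Theorems

open Summit.Ventures.Crystal3D Finset
open Literature.MathematicalPhysics.StatisticalMechanics (barlowPos barlowStacking fccStacking
  barlowOffset constHagg haggLabel_const barlowPos_apply_zero barlowPos_apply_one barlowPos_apply_two
  orderedContacts contactDeficiency)
open scoped InnerProductSpace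

/-! ### The three unit vectors of the coset `Λ₀ + w` -/

/-- **The unit vectors of `Λ₀ + w`.**  If `v − w ∈ Λ₀` and `‖v‖ = 1` then `v − w` is one of the
sites `(1,−1,−1)`, `(1,0,−1)`, `(1,−1,0)` (i.e. `v = t − u − v + w`, `t − v + w`, `t − u + w`). -/
theorem fcc_coset_unit_vectors (v : EuclideanSpace ℝ (Fin 3))
    (hv : v - barlowOffset 1 ∈ fccStacking 1 (Real.sqrt (2 / 3))) (h1 : ‖v‖ = 1) :
    ∃ c ∈ ([((1 : ℤ), (-1 : ℤ), (-1 : ℤ)), (1, 0, -1), (1, -1, 0)] : List (ℤ × ℤ × ℤ)),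
      v = barlowPos 1 (Real.sqrt (2 / 3)) constHagg c.1 c.2.1 c.2.2 + barlowOffset 1 := by
  obtain ⟨K, I, J, hK⟩ := hv
  have hv' : v = barlowPos 1 (Real.sqrt (2 / 3)) constHagg K I J + barlowOffset 1 := by
    rw [← hK]; abel
  have h3 : Real.sqrt 3 ^ 2 = 3 := Real.sq_sqrt (by norm_num)
  have hh : Real.sqrt (2 / 3) ^ 2 = 2 / 3 := Real.sq_sqrt (by norm_num)
  have hv0 : v 0 = (I : ℝ) + J / 2 + K / 2 + 1 / 2 := by
    rw [hv', PiLp.add_apply, barlowPos_apply_zero, haggLabel_const]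
    simp [barlowOffset]
  have hv1 : v 1 = Real.sqrt 3 / 2 * ((J : ℝ) + K / 3) + Real.sqrt 3 / 6 := by
    rw [hv', PiLp.add_apply, barlowPos_apply_one, haggLabel_const]
    simp [barlowOffset]
  have hv2 : v 2 = (K : ℝ) * Real.sqrt (2 / 3) := by
    rw [hv', PiLp.add_apply, barlowPos_apply_two]
    simp [barlowOffset]
  have hnorm : ‖v‖ ^ 2 = v 0 ^ 2 + v 1 ^ 2 + v 2 ^ 2 := by
    rw [EuclideanSpace.real_norm_sq_eq, Fin.sum_univ_three]
  rw [h1, one_pow, hv0, hv1, hv2] at hnorm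
  have hR : ((3 * I + K + 1) ^ 2 + (3 * I + K + 1) * (3 * J + K + 1) + (3 * J + K + 1) ^ 2 +
      6 * K ^ 2 : ℝ) = 9 := by
    have e : (Real.sqrt 3 / 2 * ((J : ℝ) + K / 3) + Real.sqrt 3 / 6) ^ 2 =
        3 * ((3 * J + K + 1) / 6) ^ 2 := by
      have : Real.sqrt 3 / 2 * ((J : ℝ) + K / 3) + Real.sqrt 3 / 6 =
          Real.sqrt 3 * ((3 * J + K + 1) / 6) := by ring
      rw [this, mul_pow, h3]
    have e2 : ((K : ℝ) * Real.sqrt (2 / 3)) ^ 2 = 2 / 3 * K ^ 2 := by rw [mul_pow, hh]; ring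
    rw [e, e2] at hnorm
    nlinarith [hnorm]
  have hZ : (3 * I + K + 1) ^ 2 + (3 * I + K + 1) * (3 * J + K + 1) + (3 * J + K + 1) ^ 2 +
      6 * K ^ 2 = 9 := by exact_mod_cast hR
  generalize hA : 3 * I + K + 1 = A at hZ
  generalize hB : 3 * J + K + 1 = B at hZ
  have hK2 : K ^ 2 ≤ 1 := by nlinarith [sq_nonneg (2 * A + B), sq_nonneg B]
  have hB2 : B ^ 2 ≤ 12 := by nlinarith [sq_nonneg (2 * A + B), sq_nonneg K]
  have hA2 : A ^ 2 ≤ 12 := by nlinarith [sq_nonneg (2 * B + A), sq_nonneg K]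
  have hKb : -1 ≤ K ∧ K ≤ 1 := by constructor <;> nlinarith
  have hBb : -3 ≤ B ∧ B ≤ 3 := by constructor <;> nlinarith
  have hAb : -3 ≤ A ∧ A ≤ 3 := by constructor <;> nlinarith
  have hIb : -1 ≤ I ∧ I ≤ 1 := by omega
  have hJb : -1 ≤ J ∧ J ≤ 1 := by omega
  have key : ∀ K₁ ∈ Finset.Icc (-1 : ℤ) 1, ∀ I₁ ∈ Finset.Icc (-1 : ℤ) 1, ∀ J₁ ∈ Finset.Icc (-1 : ℤ) 1,
      (3 * I₁ + K₁ + 1) ^ 2 + (3 * I₁ + K₁ + 1) * (3 * J₁ + K₁ + 1) + (3 * J₁ + K₁ + 1) ^ 2 +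
        6 * K₁ ^ 2 = 9 →
      (K₁, I₁, J₁) ∈ ([((1 : ℤ), (-1 : ℤ), (-1 : ℤ)), (1, 0, -1), (1, -1, 0)] : List (ℤ × ℤ × ℤ)) := by
    decide
  have hmem := key K (Finset.mem_Icc.2 hKb) I (Finset.mem_Icc.2 hIb) J (Finset.mem_Icc.2 hJb)
    (by rw [hA, hB]; exact hZ)
  exact ⟨(K, I, J), hmem, hv'⟩

/-- **The eighteen contact vectors of the basal Barlow positions.**  If `q, x ∈ B` are at distance
`1`, then `x − q` is `± pos c` for one of the six bond triples `c`, or `±(pos c + w)` for one of the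
three twin-hollow triples. -/
theorem basal_unit_vectors {q x : EuclideanSpace ℝ (Fin 3)}
    (hq : q ∈ fccStacking 1 (Real.sqrt (2 / 3)) ∨ q - barlowOffset 1 ∈ fccStacking 1 (Real.sqrt (2 / 3)) ∨
      q + barlowOffset 1 ∈ fccStacking 1 (Real.sqrt (2 / 3)))
    (hx : x ∈ fccStacking 1 (Real.sqrt (2 / 3)) ∨ x - barlowOffset 1 ∈ fccStacking 1 (Real.sqrt (2 / 3)) ∨
      x + barlowOffset 1 ∈ fccStacking 1 (Real.sqrt (2 / 3)))
    (hd : dist q x = 1) :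
    (∃ c ∈ ([((0 : ℤ), (1 : ℤ), (0 : ℤ)), (0, 0, 1), (1, 0, 0), (0, 1, -1), (-1, 1, 0), (-1, 0, 1)] :
        List (ℤ × ℤ × ℤ)),
        x - q = barlowPos 1 (Real.sqrt (2 / 3)) constHagg c.1 c.2.1 c.2.2 ∨
        x - q = -barlowPos 1 (Real.sqrt (2 / 3)) constHagg c.1 c.2.1 c.2.2) ∨
      (∃ c ∈ ([((1 : ℤ), (-1 : ℤ), (-1 : ℤ)), (1, 0, -1), (1, -1, 0)] : List (ℤ × ℤ × ℤ)),
        x - q = barlowPos 1 (Real.sqrt (2 / 3)) constHagg c.1 c.2.1 c.2.2 + barlowOffset 1 ∨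
        x - q = -(barlowPos 1 (Real.sqrt (2 / 3)) constHagg c.1 c.2.1 c.2.2 + barlowOffset 1)) := by
  set Λ := fccStacking 1 (Real.sqrt (2 / 3)) with hΛ
  set w : EuclideanSpace ℝ (Fin 3) := barlowOffset 1 with hw
  have hn : ‖x - q‖ = 1 := by rw [← dist_eq_norm, dist_comm]; exact hd
  have h3w : (3 : ℝ) • w ∈ Λ := three_barlowOffset_mem
  have caseΛ : x - q ∈ Λ → (∃ c ∈ ([((0 : ℤ), (1 : ℤ), (0 : ℤ)), (0, 0, 1), (1, 0, 0), (0, 1, -1),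
        (-1, 1, 0), (-1, 0, 1)] : List (ℤ × ℤ × ℤ)),
        x - q = barlowPos 1 (Real.sqrt (2 / 3)) constHagg c.1 c.2.1 c.2.2 ∨
        x - q = -barlowPos 1 (Real.sqrt (2 / 3)) constHagg c.1 c.2.1 c.2.2) := by
    intro hv
    have h0 : (0 : EuclideanSpace ℝ (Fin 3)) ∈ Λ := ⟨0, 0, 0, barlowPos_zero_zero_zero.symm⟩
    obtain ⟨c, hc, hcx⟩ := fcc_unit_directions 0 (x - q) h0 hv
      (by rw [dist_eq_norm, zero_sub, norm_neg, hn])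
    rw [zero_add, zero_sub] at hcx
    exact ⟨c, hc, hcx⟩
  have caseUp : x - q - w ∈ Λ → ∃ c ∈ ([((1 : ℤ), (-1 : ℤ), (-1 : ℤ)), (1, 0, -1), (1, -1, 0)] :
      List (ℤ × ℤ × ℤ)),
        x - q = barlowPos 1 (Real.sqrt (2 / 3)) constHagg c.1 c.2.1 c.2.2 + barlowOffset 1 ∨
        x - q = -(barlowPos 1 (Real.sqrt (2 / 3)) constHagg c.1 c.2.1 c.2.2 + barlowOffset 1) := by
    intro hv
    obtain ⟨c, hc, hcv⟩ := fcc_coset_unit_vectors (x - q) hv hn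
    exact ⟨c, hc, Or.inl hcv⟩
  have caseDown : x - q + w ∈ Λ → ∃ c ∈ ([((1 : ℤ), (-1 : ℤ), (-1 : ℤ)), (1, 0, -1), (1, -1, 0)] :
      List (ℤ × ℤ × ℤ)),
        x - q = barlowPos 1 (Real.sqrt (2 / 3)) constHagg c.1 c.2.1 c.2.2 + barlowOffset 1 ∨
        x - q = -(barlowPos 1 (Real.sqrt (2 / 3)) constHagg c.1 c.2.1 c.2.2 + barlowOffset 1) := by
    intro hv
    obtain ⟨c, hc, hcv⟩ := fcc_coset_unit_vectors (-(x - q)) (by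
      have : -(x - q) - barlowOffset 1 = -(x - q + w) := by rw [hw]; abel
      rw [this]; exact fcc_neg_mem hv) (by rw [norm_neg, hn])
    refine ⟨c, hc, Or.inr ?_⟩
    rw [← hcv, neg_neg]
  rcases hq with hq | hq | hq <;> rcases hx with hx | hx | hx
  · exact Or.inl (caseΛ (fcc_sub_site_mem hx hq))
  · exact Or.inr (caseUp (by have := fcc_sub_site_mem hx hq; rwa [show x - w - q = x - q - w by abel] at this))
  · exact Or.inr (caseDown (by have := fcc_sub_site_mem hx hq; rwa [show x + w - q = x - q + w by abel] at this))
  · exact Or.inr (caseDown (by have := fcc_sub_site_mem hx hq; rwa [show x - (q - w) = x - q + w by abel] at this))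
  · exact Or.inl (caseΛ (by have := fcc_sub_site_mem hx hq; rwa [show x - w - (q - w) = x - q by abel] at this))
  · refine Or.inr (caseUp ?_)
    have h1 := fcc_sub_site_mem hx hq
    have h2 := fcc_sub_site_mem h1 h3w
    rwa [show x + w - (q - w) - (3 : ℝ) • w = x - q - w by module] at h2
  · exact Or.inr (caseUp (by have := fcc_sub_site_mem hx hq; rwa [show x - (q + w) = x - q - w by abel] at this))
  · refine Or.inr (caseDown ?_)
    have h1 := fcc_sub_site_mem hx hq
    have h2 := fcc_add_site_mem h1 h3w
    rwa [show x - w - (q + w) + (3 : ℝ) • w = x - q + w by module] at h2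
  · exact Or.inl (caseΛ (by have := fcc_sub_site_mem hx hq; rwa [show x + w - (q + w) = x - q by abel] at this))

/-! ### Heights along the axis `u + v + t` and the three incompatibility norms -/

/-- `⟪p, pos (1,1,1)⟫ = 2 p₀ + (2√3/3) p₁ + √(2/3) p₂`. -/
theorem inner_axis_apply (p : EuclideanSpace ℝ (Fin 3)) :
    ⟪p, barlowPos 1 (Real.sqrt (2 / 3)) constHagg 1 1 1⟫_ℝ =
      2 * p 0 + 2 * Real.sqrt 3 / 3 * p 1 + Real.sqrt (2 / 3) * p 2 := by
  rw [EuclideanSpace.inner_eq_star_dotProduct]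
  simp only [star_trivial, dotProduct, Fin.sum_univ_three]
  simp only [barlowPos_apply_zero, barlowPos_apply_one, barlowPos_apply_two, haggLabel_const]
  push_cast
  ring

/-- Heights of the sites: `⟪pos (k,i,j), pos (1,1,1)⟫ = 2 (i + j + k)`. -/
theorem inner_axis_barlowPos (k i j : ℤ) :
    ⟪barlowPos 1 (Real.sqrt (2 / 3)) constHagg k i j, barlowPos 1 (Real.sqrt (2 / 3)) constHagg 1 1 1⟫_ℝ
      = 2 * ((i : ℝ) + j + k) := by
  have h3 : Real.sqrt 3 ^ 2 = 3 := Real.sq_sqrt (by norm_num)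
  have hh : Real.sqrt (2 / 3) ^ 2 = 2 / 3 := Real.sq_sqrt (by norm_num)
  rw [inner_axis_apply]
  simp only [barlowPos_apply_zero, barlowPos_apply_one, barlowPos_apply_two, haggLabel_const]
  linear_combination (((j : ℝ) + k / 3) / 3) * h3 + (k : ℝ) * hh

/-- Height of the letter offset: `⟪w, pos (1,1,1)⟫ = 4/3`. -/
theorem inner_axis_barlowOffset :
    ⟪barlowOffset 1, barlowPos 1 (Real.sqrt (2 / 3)) constHagg 1 1 1⟫_ℝ = 4 / 3 := by
  have h3 : Real.sqrt 3 ^ 2 = 3 := Real.sq_sqrt (by norm_num)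
  rw [inner_axis_apply]
  simp [barlowOffset]
  nlinarith [h3]

/-- `‖w‖² = 1/3`. -/
theorem norm_sq_barlowOffset' : ‖(barlowOffset 1 : EuclideanSpace ℝ (Fin 3))‖ ^ 2 = 1 / 3 := by
  have h3 : Real.sqrt 3 ^ 2 = 3 := Real.sq_sqrt (by norm_num)
  rw [EuclideanSpace.real_norm_sq_eq, Fin.sum_univ_three]
  simp [barlowOffset]
  nlinarith [h3]

/-- `‖w − u‖² = 1/3` (`u` the site `(0,1,0)`). -/
theorem norm_sq_barlowOffset_sub_u :
    ‖(barlowOffset 1 : EuclideanSpace ℝ (Fin 3)) - barlowPos 1 (Real.sqrt (2 / 3)) constHagg 0 1 0‖ ^ 2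
      = 1 / 3 := by
  have h3 : Real.sqrt 3 ^ 2 = 3 := Real.sq_sqrt (by norm_num)
  rw [EuclideanSpace.real_norm_sq_eq, Fin.sum_univ_three]
  simp [barlowOffset, barlowPos_apply_zero, barlowPos_apply_one, barlowPos_apply_two]
  nlinarith [h3]

/-- `‖w − v‖² = 1/3` (`v` the site `(0,0,1)`). -/
theorem norm_sq_barlowOffset_sub_v :
    ‖(barlowOffset 1 : EuclideanSpace ℝ (Fin 3)) - barlowPos 1 (Real.sqrt (2 / 3)) constHagg 0 0 1‖ ^ 2
      = 1 / 3 := by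
  have h3 : Real.sqrt 3 ^ 2 = 3 := Real.sq_sqrt (by norm_num)
  rw [EuclideanSpace.real_norm_sq_eq, Fin.sum_univ_three]
  simp [barlowOffset, barlowPos_apply_zero, barlowPos_apply_one, barlowPos_apply_two]
  nlinarith [h3]

end Summit.Ventures.Crystal3D.Theorems

end
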